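import Summits.QuantumAdvantage.QuantumAdvantage.Theorems.LinnikCubicClassGroupsPureCubicClassGroupFBQPStubCubicFilteredCycle
import Summits.QuantumAdvantage.QuantumAdvantage.Theorems.LinnikCubicClassGroupsPureCubicClassGroupFBQPStubRelationLatticeIndex
import Literature.NumberTheory.CubicFields.RelationLatticeLift
import Literature.NumberTheory.CubicFields.VoronoiCylinderStep
import Mathlib.NumberTheory.NumberField.ClassNumber

/-!
# Crux `LinnikCubicClassGroups.PureCubicClassGroupFBQP` (stmt-QuantumAdvantage-11544) — stub `stub_classTableSem`, part CLASSES

Line `arakelov-giant-step-cycle`, stub `stub_classTableSem` (S5b-P5b), THIRD PART: the CLASS BOOKKEEPING of the class table.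
For nonzero integral ideals `𝔤_t` (`t < T`) of a cubic field with a real embedding `σ₁`, a non-real `σ₂` and regulator unit
`ε` (`σ₁ ε > 1`, `log σ₁ ε = R_K`), and digits `e_t(E) = E / M^t mod M`:

* the RELATION LATTICE `Λ = {v ∈ ℤ^T | ∏ [𝔤_t]^{v_t} = 1}` (index = order of the subgroup generated by the classes `[𝔤_t]`,
  `stub_relationLatticeIndex`), class indices `cls E` of `A_E = ∏ 𝔤_t^{e_t(E)}` with `cls E = cls E' ↔ e(E) − e(E') ∈ Λ`;
* fixed representatives `A_g` of the classes and POSITIVE multipliers `α_E` with `A_E = α_E · A_{cls E}`;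
* a real vector `λ` with `log σ₁ α_{E'} − log σ₁ α_E ≡ Σ_t λ_t (e_t(E') − e_t(E)) (mod R_K)` whenever `cls E = cls E'`
  (the distance homomorphism `v ↦ log σ₁ β_v` of `Λ`, `(β_v) = ∏ 𝔤_t^{v_t}`, is additive modulo `R_K` because positive units
  are powers of `ε`; lift it with `exists_linear_lift_mod`).
-/

set_option linter.dupNamespace false

namespace Summit.QuantumAdvantage.QuantumAdvantage.Theorems.LinnikCubicClassGroups

open scoped NumberField nonZeroDivisors
open NumberField
open Literature.NumberTheory.CubicFields

section Classes

variable {K : Type} [Field K] [NumberField K] {σ₁ : K →+* ℝ} {σ₂ : K →+* ℂ}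
variable (hdeg : Module.finrank ℚ K = 3) (hσ₂ : ∃ z : K, starRingEnd ℂ (σ₂ z) ≠ σ₂ z)
  {ε : (𝓞 K)ˣ} (hε : 1 < σ₁ (algebraMap (𝓞 K) K ε)) (hreg : Real.log (σ₁ (algebraMap (𝓞 K) K ε)) = Units.regulator K)

/-- A generator of a principal fractional ideal may be taken with positive real conjugate. -/
theorem exists_pos_generator {I : FractionalIdeal (𝓞 K)⁰ K} (hI : I ≠ 0) {x : K}
    (hx : I = FractionalIdeal.spanSingleton (𝓞 K)⁰ x) :
    ∃ β : K, 0 < σ₁ β ∧ I = FractionalIdeal.spanSingleton (𝓞 K)⁰ β := by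
  have hx0 : x ≠ 0 := by rintro rfl; rw [FractionalIdeal.spanSingleton_zero] at hx; exact hI hx
  rcases lt_or_gt_of_ne ((map_ne_zero σ₁).mpr hx0) with h | h
  · refine ⟨-x, by rw [map_neg]; linarith, ?_⟩
    rw [hx]
    have : (-x : K) = ((-1 : (𝓞 K)ˣ) : 𝓞 K) • x := by simp
    rw [this]
    exact (FractionalIdeal.spanSingleton_eq_spanSingleton.mpr ⟨-1, rfl⟩)
  · exact ⟨x, h, hx⟩

include hdeg hσ₂ hε hreg in
/-- Two positive generators of the same principal ideal have logarithms differing by an integer multiple of `R_K`. -/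
theorem log_sub_log_of_spanSingleton_eq {x y : K} (hx : 0 < σ₁ x) (hy : 0 < σ₁ y)
    (h : FractionalIdeal.spanSingleton (𝓞 K)⁰ x = FractionalIdeal.spanSingleton (𝓞 K)⁰ y) :
    ∃ q : ℤ, Real.log (σ₁ y) - Real.log (σ₁ x) = q * Units.regulator K := by
  obtain ⟨z, hz⟩ := FractionalIdeal.spanSingleton_eq_spanSingleton.mp h
  rw [Units.smul_def, Algebra.smul_def] at hz
  have hzpos : 0 < σ₁ (algebraMap (𝓞 K) K z) := by
    have h1 := hy
    rw [← hz, map_mul] at h1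
    exact (mul_pos_iff_of_pos_right hx).mp h1
  obtain ⟨q, hq⟩ := unit_eq_zpow_of_pos hdeg σ₁ σ₂ hσ₂ hε hreg z hzpos
  refine ⟨q, ?_⟩
  have hε0 : 0 < σ₁ (algebraMap (𝓞 K) K ε) := by linarith
  rw [← hz, map_mul, hq, map_zpow₀, Real.log_mul (zpow_pos hε0 q).ne' hx.ne', Real.log_zpow, hreg]; ring

include hdeg hσ₂ hε hreg in
/-- **The class bookkeeping of the class table.** -/
theorem classes_package (T M : ℕ) (𝔤 : ℕ → Ideal (𝓞 K)) (h𝔤 : ∀ t, t < T → 𝔤 t ≠ ⊥) :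
    ∃ (Λ : AddSubgroup (Fin T → ℤ)) (_ : Λ.FiniteIndex) (cls : ℕ → ℕ) (Ag : ℕ → FractionalIdeal (𝓞 K)⁰ K)
      (α : ℕ → K) (lam : Fin T → ℝ),
      Λ.index = Nat.card (Subgroup.closure (Set.range fun t : Fin T =>
        ClassGroup.mk0 (⟨𝔤 t, mem_nonZeroDivisors_iff_ne_zero.mpr (h𝔤 t t.isLt)⟩ : (Ideal (𝓞 K))⁰))) ∧
      (∀ E E', cls E = cls E' ↔
        (fun t : Fin T => ((E / M ^ (t : ℕ) % M : ℕ) : ℤ) - ((E' / M ^ (t : ℕ) % M : ℕ) : ℤ)) ∈ Λ) ∧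
      (∀ g, Ag g ≠ 0) ∧
      (∀ E, 0 < σ₁ (α E) ∧ (∏ t ∈ Finset.range T, ((𝔤 t : Ideal (𝓞 K)) : FractionalIdeal (𝓞 K)⁰ K) ^ (E / M ^ t % M)) =
        FractionalIdeal.spanSingleton (𝓞 K)⁰ (α E) * Ag (cls E)) ∧
      (∀ E E', cls E = cls E' → ∃ z : ℤ, Real.log (σ₁ (α E')) - Real.log (σ₁ (α E)) -
        ∑ t : Fin T, lam t * (((E' / M ^ (t : ℕ) % M : ℕ) : ℝ) - ((E / M ^ (t : ℕ) % M : ℕ) : ℝ)) = z * Units.regulator K) ∧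
      (∀ E E' (x x' : K), x ≠ 0 → x' ≠ 0 →
        FractionalIdeal.spanSingleton (𝓞 K)⁰ x * Ag (cls E) = FractionalIdeal.spanSingleton (𝓞 K)⁰ x' * Ag (cls E') →
        cls E = cls E') := by
  classical
  set G := ClassGroup (𝓞 K) with hG
  set g0 : Fin T → (Ideal (𝓞 K))⁰ := fun t => ⟨𝔤 t, mem_nonZeroDivisors_iff_ne_zero.mpr (h𝔤 t t.isLt)⟩ with hg0
  set uI : Fin T → (FractionalIdeal (𝓞 K)⁰ K)ˣ := fun t => FractionalIdeal.mk0 K (g0 t) with huI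
  set c : Fin T → G := fun t => ClassGroup.mk0 (g0 t) with hc
  have hcmk : ∀ t, ClassGroup.mk K (uI t) = c t := fun t => ClassGroup.mk_mk0 K (g0 t)
  obtain ⟨φ, hφ, hidx⟩ := stub_relationLatticeIndex G T c
  set Λ : AddSubgroup (Fin T → ℤ) := AddSubgroup.toSubgroup.symm φ.ker with hΛ
  have hmemΛ : ∀ v, v ∈ Λ ↔ ∏ t, c t ^ v t = 1 := fun v => by
    change Multiplicative.ofAdd v ∈ φ.ker ↔ _
    rw [MonoidHom.mem_ker, hφ]
  have hΛidx : Λ.index = φ.ker.index := by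
    rw [← AddSubgroup.index_toSubgroup, hΛ, OrderIso.apply_symm_apply]
  haveI hfin : Λ.FiniteIndex := by
    refine ⟨?_⟩
    rw [hΛidx, hidx]
    exact Nat.card_pos.ne'
  -- unit products and their classes
  set U : (Fin T → ℤ) → (FractionalIdeal (𝓞 K)⁰ K)ˣ := fun v => ∏ t, uI t ^ v t with hU
  have hUmk : ∀ v, ClassGroup.mk K (U v) = ∏ t, c t ^ v t := fun v => by
    rw [hU, map_prod]; simp_rw [map_zpow, hcmk]
  have hUadd : ∀ v w, U (v + w) = U v * U w := fun v w => by
    rw [hU, ← Finset.prod_mul_distrib]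
    exact Finset.prod_congr rfl fun t _ => by rw [Pi.add_apply, zpow_add]
  set d : ℕ → Fin T → ℤ := fun E t => ((E / M ^ (t : ℕ) % M : ℕ) : ℤ) with hd
  have hUcoe : ∀ E, (U (d E) : FractionalIdeal (𝓞 K)⁰ K) =
      ∏ t ∈ Finset.range T, ((𝔤 t : Ideal (𝓞 K)) : FractionalIdeal (𝓞 K)⁰ K) ^ (E / M ^ t % M) := by
    intro E
    rw [hU, Units.coe_prod, ← Fin.prod_univ_eq_prod_range (fun t => ((𝔤 t : Ideal (𝓞 K)) : FractionalIdeal (𝓞 K)⁰ K) ^ (E / M ^ t % M))]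
    refine Finset.prod_congr rfl fun t _ => ?_
    rw [hd, Units.val_zpow_eq_zpow_val, zpow_natCast, huI, FractionalIdeal.coe_mk0]
  -- classes
  set eqv := Fintype.equivFin G with heqv
  set clsG : ℕ → G := fun E => ClassGroup.mk K (U (d E)) with hclsG
  set cls : ℕ → ℕ := fun E => ((eqv (clsG E) : Fin _) : ℕ) with hcls
  have hcls_iff : ∀ E E', cls E = cls E' ↔ clsG E = clsG E' := fun E E' =>
    Fin.val_injective.eq_iff.trans eqv.injective.eq_iff
  have hclsG_iff : ∀ E E', clsG E = clsG E' ↔ (d E - d E') ∈ Λ := fun E E' => by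
    rw [hmemΛ, ← hUmk, show d E - d E' = d E + (-(d E')) by ring, hUadd, map_mul]
    have hneg : U (-(d E')) = (U (d E'))⁻¹ := by
      rw [hU, ← Finset.prod_inv_distrib]
      exact Finset.prod_congr rfl fun t _ => by rw [Pi.neg_apply, zpow_neg]
    rw [hneg, map_inv, mul_inv_eq_one]
  -- representatives
  have hsurj := ClassGroup.mk0_surjective (R := 𝓞 K)
  set rep0 : ℕ → (Ideal (𝓞 K))⁰ := fun g =>
    if h : g < Fintype.card G then Classical.choose (hsurj (eqv.symm ⟨g, h⟩)) else 1 with hrep0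
  set Ag : ℕ → FractionalIdeal (𝓞 K)⁰ K := fun g => ((rep0 g : Ideal (𝓞 K)) : FractionalIdeal (𝓞 K)⁰ K) with hAg
  have hAg0 : ∀ g, Ag g ≠ 0 := fun g =>
    FractionalIdeal.coeIdeal_ne_zero.mpr (nonZeroDivisors.ne_zero (rep0 g).2)
  have hAgmk : ∀ g, (FractionalIdeal.mk0 K (rep0 g) : FractionalIdeal (𝓞 K)⁰ K) = Ag g := fun g =>
    FractionalIdeal.coe_mk0 K _
  have hrep : ∀ E, ClassGroup.mk K (FractionalIdeal.mk0 K (rep0 (cls E))) = clsG E := fun E => by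
    rw [ClassGroup.mk_mk0]
    have h : cls E < Fintype.card G := (eqv (clsG E)).isLt
    have e : rep0 (cls E) = Classical.choose (hsurj (eqv.symm ⟨cls E, h⟩)) := by rw [hrep0]; exact dif_pos h
    rw [e, Classical.choose_spec (hsurj (eqv.symm ⟨cls E, h⟩))]
    change eqv.symm ⟨((eqv (clsG E) : Fin _) : ℕ), h⟩ = clsG E
    rw [Fin.eta, Equiv.symm_apply_apply]
  have hrep_inj : ∀ E E', ClassGroup.mk K (FractionalIdeal.mk0 K (rep0 (cls E))) =
      ClassGroup.mk K (FractionalIdeal.mk0 K (rep0 (cls E'))) → cls E = cls E' := fun E E' h => by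
    rw [hrep, hrep] at h; exact (hcls_iff E E').2 h
  -- positive multipliers `α_E`
  have hαex : ∀ E, ∃ α : K, 0 < σ₁ α ∧ (U (d E) : FractionalIdeal (𝓞 K)⁰ K) =
      FractionalIdeal.spanSingleton (𝓞 K)⁰ α * Ag (cls E) := by
    intro E
    have h1 : ClassGroup.mk K (U (d E) * (FractionalIdeal.mk0 K (rep0 (cls E)))⁻¹) = 1 := by
      rw [map_mul, map_inv, hrep, hclsG, mul_inv_cancel]
    rw [ClassGroup.mk_eq_one_iff] at h1
    obtain ⟨x, hx⟩ := (FractionalIdeal.isPrincipal_iff _).1 h1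
    have hP0 : ((U (d E) * (FractionalIdeal.mk0 K (rep0 (cls E)))⁻¹ : (FractionalIdeal (𝓞 K)⁰ K)ˣ) :
        FractionalIdeal (𝓞 K)⁰ K) ≠ 0 := Units.ne_zero _
    obtain ⟨β, hβ, hβeq⟩ := exists_pos_generator (σ₁ := σ₁) hP0 hx
    refine ⟨β, hβ, ?_⟩
    have h2 := congrArg (fun J : FractionalIdeal (𝓞 K)⁰ K => J * Ag (cls E)) hβeq
    rw [← h2, Units.val_mul, Units.val_inv_eq_inv_val, hAgmk, mul_assoc, inv_mul_cancel₀ (hAg0 _), mul_one]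
  choose α hαpos hαeq using hαex
  -- the distance homomorphism of `Λ`
  have hβex : ∀ v : Fin T → ℤ, ∃ β : K, v ∈ Λ →
      (0 < σ₁ β ∧ (U v : FractionalIdeal (𝓞 K)⁰ K) = FractionalIdeal.spanSingleton (𝓞 K)⁰ β) := by
    intro v
    by_cases hv : v ∈ Λ
    · have h1 : ClassGroup.mk K (U v) = 1 := by rw [hUmk]; exact (hmemΛ v).1 hv
      rw [ClassGroup.mk_eq_one_iff] at h1
      obtain ⟨x, hx⟩ := (FractionalIdeal.isPrincipal_iff _).1 h1
      obtain ⟨β, hβ, hβeq⟩ := exists_pos_generator (σ₁ := σ₁) (Units.ne_zero _) hx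
      exact ⟨β, fun _ => ⟨hβ, hβeq⟩⟩
    · exact ⟨1, fun h => absurd h hv⟩
  choose β hβ using hβex
  set f : (Fin T → ℤ) → ℝ := fun v => Real.log (σ₁ (β v)) with hf
  have hfadd : ∀ v ∈ Λ, ∀ w ∈ Λ, ∃ z : ℤ, f (v + w) - f v - f w = z * Units.regulator K := by
    intro v hv w hw
    obtain ⟨hv1, hv2⟩ := hβ v hv
    obtain ⟨hw1, hw2⟩ := hβ w hw
    obtain ⟨hvw1, hvw2⟩ := hβ (v + w) (Λ.add_mem hv hw)
    have heq : FractionalIdeal.spanSingleton (𝓞 K)⁰ (β v * β w) = FractionalIdeal.spanSingleton (𝓞 K)⁰ (β (v + w)) := by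
      rw [← hvw2, hUadd, Units.val_mul, hv2, hw2, FractionalIdeal.spanSingleton_mul_spanSingleton]
    obtain ⟨q, hq⟩ := log_sub_log_of_spanSingleton_eq hdeg hσ₂ hε hreg (by rw [map_mul]; exact mul_pos hv1 hw1) hvw1 heq
    refine ⟨q, ?_⟩
    change Real.log (σ₁ (β (v + w))) - Real.log (σ₁ (β v)) - Real.log (σ₁ (β w)) = q * Units.regulator K
    rw [map_mul, Real.log_mul hv1.ne' hw1.ne'] at hq
    linarith
  obtain ⟨lam, hlam⟩ := exists_linear_lift_mod Λ (Units.regulator K) f hfadd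
  refine ⟨Λ, hfin, cls, Ag, α, lam, by change Λ.index = Nat.card (Subgroup.closure (Set.range c)); rw [hΛidx, hidx], fun E E' => (hcls_iff E E').trans (hclsG_iff E E'), hAg0,
    fun E => ⟨hαpos E, by rw [← hUcoe]; exact hαeq E⟩, fun E E' hEE' => ?_, fun E E' x x' hx hx' h => ?_⟩
  · -- exact affinity along a class
    set v : Fin T → ℤ := d E' - d E with hv
    have hvΛ : v ∈ Λ := (hclsG_iff E' E).1 ((hcls_iff E' E).1 hEE'.symm)
    obtain ⟨hv1, hv2⟩ := hβ v hvΛ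
    have hUE' : U (d E') = U (d E) * U v := by rw [← hUadd]; congr 1; rw [hv]; abel
    have h1 : (U (d E') : FractionalIdeal (𝓞 K)⁰ K) = FractionalIdeal.spanSingleton (𝓞 K)⁰ (α E') * Ag (cls E) := by
      rw [hEE']; exact hαeq E'
    have hideal : FractionalIdeal.spanSingleton (𝓞 K)⁰ (α E') * Ag (cls E) =
        FractionalIdeal.spanSingleton (𝓞 K)⁰ (α E * β v) * Ag (cls E) := by
      rw [← h1, hUE', Units.val_mul, hαeq E, hv2, ← FractionalIdeal.spanSingleton_mul_spanSingleton]
      ring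
    have hcancel : FractionalIdeal.spanSingleton (𝓞 K)⁰ (α E * β v) = FractionalIdeal.spanSingleton (𝓞 K)⁰ (α E') :=
      (mul_right_cancel₀ (hAg0 _) hideal).symm
    obtain ⟨q, hq⟩ := log_sub_log_of_spanSingleton_eq hdeg hσ₂ hε hreg
      (by rw [map_mul]; exact mul_pos (hαpos E) hv1) (hαpos E') hcancel
    obtain ⟨z, hz⟩ := hlam v hvΛ
    refine ⟨q + z, ?_⟩
    rw [map_mul, Real.log_mul (hαpos E).ne' hv1.ne'] at hq
    have hsum : ∑ t : Fin T, lam t * (((E' / M ^ (t : ℕ) % M : ℕ) : ℝ) - ((E / M ^ (t : ℕ) % M : ℕ) : ℝ)) =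
        ∑ t, lam t * (v t : ℝ) := Finset.sum_congr rfl fun t _ => by
          simp only [hv, hd, Pi.sub_apply, Int.cast_sub, Int.cast_natCast]
    rw [hsum]
    have hf' : f v = Real.log (σ₁ (β v)) := rfl
    push_cast
    linarith
  · -- class representatives with a common multiple lie in one class
    apply hrep_inj
    rw [ClassGroup.mk_mk0, ClassGroup.mk_mk0]
    apply (ClassGroup.mk0_eq_mk0_iff).2
    -- from `(x) A_g = (x') A_g'` in `K`, clear denominators
    obtain ⟨nx, mx, hmx, hnx⟩ := IsFractionRing.div_surjective (A := 𝓞 K) x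
    obtain ⟨nx', mx', hmx', hnx'⟩ := IsFractionRing.div_surjective (A := 𝓞 K) x'
    have hmx0 : algebraMap (𝓞 K) K mx ≠ 0 := RingOfIntegers.coe_ne_zero_iff.mpr (nonZeroDivisors.ne_zero hmx)
    have hmx'0 : algebraMap (𝓞 K) K mx' ≠ 0 := RingOfIntegers.coe_ne_zero_iff.mpr (nonZeroDivisors.ne_zero hmx')
    have hnx0 : nx ≠ 0 := by
      rintro rfl; rw [map_zero, zero_div] at hnx; exact hx hnx.symm
    have hnx'0 : nx' ≠ 0 := by
      rintro rfl; rw [map_zero, zero_div] at hnx'; exact hx' hnx'.symm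
    refine ⟨nx * mx', nx' * mx, mul_ne_zero hnx0 (nonZeroDivisors.ne_zero hmx'), mul_ne_zero hnx'0 (nonZeroDivisors.ne_zero hmx), ?_⟩
    rw [← FractionalIdeal.coeIdeal_inj (K := K), FractionalIdeal.coeIdeal_mul, FractionalIdeal.coeIdeal_mul,
      FractionalIdeal.coeIdeal_span_singleton, FractionalIdeal.coeIdeal_span_singleton]
    change FractionalIdeal.spanSingleton (𝓞 K)⁰ (algebraMap (𝓞 K) K (nx * mx')) * Ag (cls E) =
      FractionalIdeal.spanSingleton (𝓞 K)⁰ (algebraMap (𝓞 K) K (nx' * mx)) * Ag (cls E')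
    have ex : algebraMap (𝓞 K) K (nx * mx') = x * (algebraMap (𝓞 K) K mx * algebraMap (𝓞 K) K mx') := by
      rw [map_mul, ← hnx]; field_simp
    have ex' : algebraMap (𝓞 K) K (nx' * mx) = x' * (algebraMap (𝓞 K) K mx * algebraMap (𝓞 K) K mx') := by
      rw [map_mul, ← hnx']; field_simp
    rw [ex, ex']
    have h' := congrArg (fun J => J * FractionalIdeal.spanSingleton (𝓞 K)⁰ (algebraMap (𝓞 K) K mx * algebraMap (𝓞 K) K mx')) h
    simp only [mul_right_comm _ (Ag _), FractionalIdeal.spanSingleton_mul_spanSingleton] at h'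
    exact h'

end Classes

/-- **P5b helper `classTableSem_classes_package`** (registered): the class bookkeeping of the class table. -/
theorem classTableSem_classes_package : ∀ (K : Type) [Field K] [NumberField K], Module.finrank ℚ K = 3 → ∀ (σ₁ : K →+* ℝ) (σ₂ : K →+* ℂ), (∃ z : K, starRingEnd ℂ (σ₂ z) ≠ σ₂ z) → ∀ (ε : (𝓞 K)ˣ), 1 < σ₁ (algebraMap (𝓞 K) K ε) → Real.log (σ₁ (algebraMap (𝓞 K) K ε)) = NumberField.Units.regulator K → ∀ (T M : ℕ) (𝔤 : ℕ → Ideal (𝓞 K)) (h𝔤 : ∀ t, t < T → 𝔤 t ≠ ⊥), ∃ (Λ : AddSubgroup (Fin T → ℤ)) (_ : Λ.FiniteIndex) (cls : ℕ → ℕ) (Ag : ℕ → FractionalIdeal (𝓞 K)⁰ K) (α : ℕ → K) (lam : Fin T → ℝ), Λ.index = Nat.card (Subgroup.closure (Set.range fun t : Fin T => ClassGroup.mk0 (⟨𝔤 t, mem_nonZeroDivisors_iff_ne_zero.mpr (h𝔤 t t.isLt)⟩ : (Ideal (𝓞 K))⁰))) ∧ (∀ E E', cls E = cls E' ↔ (fun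 t : Fin T => ((E / M ^ (t : ℕ) % M : ℕ) : ℤ) - ((E' / M ^ (t : ℕ) % M : ℕ) : ℤ)) ∈ Λ) ∧ (∀ g, Ag g ≠ 0) ∧ (∀ E, 0 < σ₁ (α E) ∧ (∏ t ∈ Finset.range T, ((𝔤 t : Ideal (𝓞 K)) : FractionalIdeal (𝓞 K)⁰ K) ^ (E / M ^ t % M)) = FractionalIdeal.spanSingleton (𝓞 K)⁰ (α E) * Ag (cls E)) ∧ (∀ E E', cls E = cls E' → ∃ z : ℤ, Real.log (σ₁ (α E')) - Real.log (σ₁ (α E)) - ∑ t : Fin T, lam t * (((E' / M ^ (t : ℕ) % M : ℕ) : ℝ) - ((E / M ^ (t : ℕ) % M : ℕ) : ℝ)) = z * NumberField.Units.regulator K) ∧ (∀ E E' (x x' : K), x ≠ 0 → x' ≠ 0 → FractionalIdeal.spanSingleton (𝓞 K)⁰ x * Ag (cls E) = FractionalIdeal.spanSingleton (𝓞 K)⁰ x' * Ag (cls E') → cls E = cls E') :=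
  fun _ _ _ hdeg _ _ hσ₂ _ hε hreg T M 𝔤 h𝔤 => classes_package hdeg hσ₂ hε hreg T M 𝔤 h𝔤


end Summit.QuantumAdvantage.QuantumAdvantage.Theorems.LinnikCubicClassGroups
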